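import Literature.LinearAlgebra.Matrix.PrincipalMinorMap
import Literature.LinearAlgebra.Matrix.PrincipalMinorMapNullCone
import Literature.LinearAlgebra.Matrix.PrincipalMinorMapDigraph

/-!
# Proof of Lin–Sturmfels 2009, Theorem 1: the image of the principal minor map is closed

Discharge of the named fact
`Literature.LinearAlgebra.Matrix.linSturmfels2009_isClosed_range_principalMinorMap`
(`PrincipalMinorMap.lean`): for every `n`, the range of the affine principal minor map
`φ_a : Matrix (Fin n) (Fin n) ℂ → (Finset (Fin n) → ℂ)`, `A ↦ (det A_I)_I`, is closed
(Shaowei Lin, Bernd Sturmfels, *Polynomial relations among principal minors of a `4 × 4`-matrix*,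
J. Algebra **322** (2009) 4121–4131 [LinSturmfels2009], Theorem 1).  We prove it for square
matrices over `ℂ` indexed by any finite type (`LinSturmfels.isClosed_range_principalMinorMap`).

## The printed proof and the road taken here

[LinSturmfels2009], §2 argues: principal minors and cycle-sums generate the same ring (Prop. 4);
products of distinct cycles with the same support factor through shorter cycles (Lemma 6); hence
the ring `ℂ[c_*]` of cycle monomials is integral over `ℂ[P_*]` (Prop. 7), so bounded principal
minors force bounded cycle values (Cor. 8); the image of the monomial map `γ = (c_π)_π` is closed
by the theory of images of toric/monomial maps [GMS], [KT], `γ` being the quotient by the torus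
`A ↦ D A D⁻¹` (Lemma 9); a limit of principal-minor vectors is then realised by a matrix realising
the limit cycle values.

Formalising Prop. 7 and Lemma 9 would require invariant theory / toric geometry absent from
Mathlib.  We keep the STATEMENT and the two structural ideas of the printed proof — invariance
under the torus `A ↦ D A D⁻¹` ([LinSturmfels2009], §1) and the combinatorics of cycle monomials
(ibid., §2, Lemma 6) — but replace Cor. 8 + Lemma 9 by an elementary compactness argument of
Kempf–Ness / Hilbert–Mumford type:

1. (`principalMinorMap_torusConj`, `exists_invariant_closed_set`) principal minors are constant on
   the closure `S_A` of the torus orbit of `A`, which is closed and torus-stable;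
2. (`exists_min_sqNorm`, `balanced_of_min`) the squared Frobenius norm attains its minimum on
   `S_A` at some `B`, and the first-order condition in the one-parameter subgroups
   `diag(1,…,t,…,1)` says that `B` is *balanced*: `Σ_j |B i j|² = Σ_j |B j i|²` for every `i`;
3. (`PrincipalMinorMapNullCone`: `LinSturmfels.nullCone`) if all principal minors of a matrix
   vanish then so do all its diagonal entries and cycle monomials — the set-theoretic shadow of
   Prop. 7, proved from the Leibniz expansion and the cycle `C₁` of the key claim of Lemma 6;
4. (`PrincipalMinorMapDigraph`: `LinSturmfels.exists_heavy_cycle`) a balanced nonzero matrix has a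
   cycle all of whose entries are large, so by 3. a balanced matrix with an entry of modulus `1`
   and all entries of modulus `≤ 1` has a nonzero principal minor; by compactness of that set the
   sum of the moduli of its principal minors is bounded below by some `δ > 0`
   (`exists_pos_lower_bound`), and rescaling gives: balanced matrices whose principal minors are
   bounded by `R` have entries bounded by `M(R)` (`exists_entry_bound`) — the substitute for
   Cor. 8 + Lemma 9;
5. (`exists_bounded_representative`, `isClosed_range_principalMinorMap`) hence every fibre-mate
   class `{B : φ B = φ A}` with `‖φ A‖ ≤ R` meets the compact box `‖B i j‖ ≤ M(R)`, so
   `im φ ∩ ball` lies in the compact set `φ(box)` and `im φ` is closed.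

No new definitions are introduced (torus conjugation, orbit closures and the squared Frobenius
norm are written out as terms).

## References

* S. Lin, B. Sturmfels, J. Algebra 322 (2009), Thm. 1, §2 (Prop. 4, Lemma 6, Prop. 7, Cor. 8,
  Lemma 9) [LinSturmfels2009].
* G. Kempf, L. Ness, *The length of vectors in representation spaces* (1979) — the minimum-norm /
  first-order-condition idea in step 2 (folklore form, not cited as a dependency).
-/

noncomputable section

open Matrix Equiv Finset

namespace Literature.LinearAlgebra.Matrix

namespace LinSturmfels

section Torus

variable {m : Type*} [Fintype m] [DecidableEq m]

/-- Principal minors are invariant under the torus action `A ↦ D A D⁻¹`, `D = diag(d)`: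
`(D A D⁻¹)_I = D_I A_I D_I⁻¹` has the same determinant. [cite: LinSturmfels2009, §1] -/
theorem principalMinorMap_torusConj (d : m → ℂˣ) (A : Matrix m m ℂ) :
    principalMinorMap (fun i j => (d i : ℂ) * A i j * ((d j : ℂ))⁻¹ : Matrix m m ℂ) =
      principalMinorMap A := by
  funext I
  unfold principalMinorMap
  have h : Matrix.submatrix (fun i j => (d i : ℂ) * A i j * ((d j : ℂ))⁻¹ : Matrix m m ℂ)
      (fun i : I => (i : m)) (fun i : I => (i : m)) =
      Matrix.diagonal (fun a : I => (d a : ℂ)) *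
        A.submatrix (fun i : I => (i : m)) (fun i : I => (i : m)) *
        Matrix.diagonal (fun a : I => ((d a : ℂ))⁻¹) := by
    ext a b
    simp [Matrix.mul_diagonal, Matrix.diagonal_mul]
  rw [h, Matrix.det_mul, Matrix.det_mul, Matrix.det_diagonal, Matrix.det_diagonal]
  have key : ∀ x y z : ℂ, y * z = 1 → y * x * z = x := fun x y z hyz => by
    calc y * x * z = x * (y * z) := by ring
      _ = x := by rw [hyz, mul_one]
  exact key _ _ _ (by rw [← Finset.prod_mul_distrib]; simp)

/-- The principal minor map is continuous (its coordinates are polynomials). [folklore] -/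
theorem continuous_principalMinorMap :
    Continuous (principalMinorMap : Matrix m m ℂ → Finset m → ℂ) := by
  unfold principalMinorMap
  exact continuous_pi fun I => (continuous_id.matrix_submatrix _ _).matrix_det

/-- Homogeneity: `(c • B)_I = c^{|I|} B_I`. [folklore] -/
theorem principalMinorMap_smul (c : ℂ) (B : Matrix m m ℂ) (I : Finset m) :
    principalMinorMap (c • B) I = c ^ I.card * principalMinorMap B I := by
  unfold principalMinorMap
  rw [show (c • B).submatrix (fun i : I => (i : m)) (fun i : I => (i : m)) =
      c • B.submatrix (fun i : I => (i : m)) (fun i : I => (i : m)) from rfl,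
    Matrix.det_smul, Fintype.card_coe]

/-- **Orbit closures.** For every `A` there is a closed, torus-stable set `S ∋ A` (the closure of
the torus orbit `{D A D⁻¹}`) on which the principal minor map is constant (invariance, §1 of the
source, plus continuity). [cite: LinSturmfels2009, §1] -/
theorem exists_invariant_closed_set (A : Matrix m m ℂ) :
    ∃ S : Set (Matrix m m ℂ), IsClosed S ∧ A ∈ S ∧
      (∀ (d : m → ℂˣ) (B : Matrix m m ℂ), B ∈ S →
        (fun i j => (d i : ℂ) * B i j * ((d j : ℂ))⁻¹ : Matrix m m ℂ) ∈ S) ∧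
      ∀ B ∈ S, principalMinorMap B = principalMinorMap A := by
  set orbit : Set (Matrix m m ℂ) :=
    Set.range fun d : m → ℂˣ => (fun i j => (d i : ℂ) * A i j * ((d j : ℂ))⁻¹ : Matrix m m ℂ)
    with horbit
  refine ⟨closure orbit, isClosed_closure, subset_closure ⟨1, by ext i j; simp⟩, ?_, ?_⟩
  · intro d B hB
    have hcont : Continuous fun B : Matrix m m ℂ =>
        (fun i j => (d i : ℂ) * B i j * ((d j : ℂ))⁻¹ : Matrix m m ℂ) :=
      continuous_pi fun i => continuous_pi fun j => by fun_prop
    refine map_mem_closure hcont hB ?_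
    rintro _ ⟨e, rfl⟩
    refine ⟨d * e, ?_⟩
    ext i j
    simp only [Pi.mul_apply, Units.val_mul, mul_inv]
    ring
  · intro B hB
    have hclosed : IsClosed {B : Matrix m m ℂ | principalMinorMap B = principalMinorMap A} :=
      isClosed_eq continuous_principalMinorMap continuous_const
    exact closure_minimal (by rintro _ ⟨d, rfl⟩; exact principalMinorMap_torusConj d A)
      hclosed hB

end Torus

section MinNorm

variable {m : Type*} [Fintype m]

omit [Fintype m] in
/-- The box `{‖B i j‖ ≤ r}` is compact (a product of closed discs). [folklore] -/
theorem isCompact_box (r : ℝ) : IsCompact {A : Matrix m m ℂ | ∀ i j, ‖A i j‖ ≤ r} := by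
  have : {A : Matrix m m ℂ | ∀ i j, ‖A i j‖ ≤ r} =
      Set.univ.pi (fun _ : m => Set.univ.pi (fun _ : m => Metric.closedBall (0 : ℂ) r)) := by
    ext A
    simp only [Set.mem_setOf_eq]
    constructor
    · intro h
      exact Set.mem_univ_pi.mpr fun i => Set.mem_univ_pi.mpr fun j => by simpa using h i j
    · intro h i j
      simpa using Set.mem_univ_pi.mp (Set.mem_univ_pi.mp h i) j
  rw [this]
  exact isCompact_univ_pi (fun _ => isCompact_univ_pi (fun _ => isCompact_closedBall 0 r))

/-- A closed nonempty set of matrices contains a matrix of minimal squared Frobenius norm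
`Σ_{i,j} ‖B i j‖²` (the sublevel set through a point is compact). [folklore] -/
theorem exists_min_sqNorm {S : Set (Matrix m m ℂ)} (hS : IsClosed S) {A : Matrix m m ℂ}
    (hA : A ∈ S) :
    ∃ B ∈ S, ∀ B' ∈ S, ∑ i, ∑ j, ‖B i j‖ ^ 2 ≤ ∑ i, ∑ j, ‖B' i j‖ ^ 2 := by
  set N : Matrix m m ℂ → ℝ := fun B => ∑ i, ∑ j, ‖B i j‖ ^ 2 with hN
  have hNc : Continuous N := by rw [hN]; fun_prop
  have hNle : ∀ (B : Matrix m m ℂ) i j, ‖B i j‖ ≤ Real.sqrt (N B) := fun B i j => by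
    rw [Real.le_sqrt (norm_nonneg _)
      (Finset.sum_nonneg fun _ _ => Finset.sum_nonneg fun _ _ => by positivity)]
    calc ‖B i j‖ ^ 2 ≤ ∑ j', ‖B i j'‖ ^ 2 :=
          Finset.single_le_sum (f := fun j' => ‖B i j'‖ ^ 2) (fun _ _ => by positivity)
            (Finset.mem_univ j)
      _ ≤ ∑ i', ∑ j', ‖B i' j'‖ ^ 2 :=
          Finset.single_le_sum (f := fun i' => ∑ j', ‖B i' j'‖ ^ 2)
            (fun _ _ => Finset.sum_nonneg fun _ _ => by positivity) (Finset.mem_univ i)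
  set K := S ∩ {B | N B ≤ N A} with hK
  have hKc : IsCompact K := by
    refine (isCompact_box (Real.sqrt (N A))).of_isClosed_subset
      (hS.inter (isClosed_le hNc continuous_const)) ?_
    rintro B ⟨-, hB⟩ i j
    exact (hNle B i j).trans (Real.sqrt_le_sqrt hB)
  have hAK : A ∈ K := ⟨hA, le_refl (N A)⟩
  obtain ⟨B, hBK, hmin⟩ := hKc.exists_isMinOn ⟨A, hAK⟩ hNc.continuousOn
  refine ⟨B, hBK.1, fun B' hB' => ?_⟩
  change N B ≤ N B'
  by_cases h : N B' ≤ N A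
  · exact hmin ⟨hB', h⟩
  · exact (hmin hAK).trans (le_of_not_ge h)

/-- Splitting a double sum off the `i`-th row and column. [folklore] -/
theorem sum_sum_split [DecidableEq m] (g : m → m → ℝ) (i : m) :
    ∑ j, ∑ l, g j l = g i i + ∑ l ∈ univ.erase i, g i l + ∑ j ∈ univ.erase i, g j i +
      ∑ j ∈ univ.erase i, ∑ l ∈ univ.erase i, g j l := by
  have h1 : ∑ j, ∑ l, g j l = ∑ l, g i l + ∑ j ∈ univ.erase i, ∑ l, g j l :=
    (Finset.add_sum_erase _ _ (Finset.mem_univ i)).symm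
  have h3 : ∀ j, ∑ l, g j l = g j i + ∑ l ∈ univ.erase i, g j l := fun j =>
    (Finset.add_sum_erase _ _ (Finset.mem_univ i)).symm
  rw [h1, h3 i, Finset.sum_congr rfl (fun j _ => h3 j), Finset.sum_add_distrib]
  ring

omit [Fintype m] in
/-- If `P + Q ≤ t² P + t⁻² Q` for all `t > 0` (`P, Q ≥ 0`), then `P = Q` (take
`t² = (P + Q)/(2P)`). [folklore] -/
theorem eq_of_forall_scaling_le {P Q : ℝ} (hP : 0 ≤ P) (hQ : 0 ≤ Q)
    (h : ∀ t : ℝ, 0 < t → P + Q ≤ t ^ 2 * P + (t ^ 2)⁻¹ * Q) : P = Q := by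
  by_cases hP0 : P = 0
  · subst hP0
    have := h 2 two_pos
    norm_num at this
    linarith
  · have hPpos : 0 < P := lt_of_le_of_ne hP (Ne.symm hP0)
    have hs : 0 < P + Q := by linarith
    set x := (P + Q) / (2 * P) with hx
    have hxpos : 0 < x := by positivity
    have := h (Real.sqrt x) (Real.sqrt_pos.mpr hxpos)
    rw [Real.sq_sqrt hxpos.le] at this
    have h1 : x * P = (P + Q) / 2 := by rw [hx]; field_simp
    have h2 : x⁻¹ * Q = 2 * P * Q / (P + Q) := by rw [hx]; field_simp
    rw [h1, h2, div_add_div _ _ two_ne_zero hs.ne', le_div_iff₀ (by positivity)] at this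
    nlinarith [sq_nonneg (P - Q)]

/-- **Minimal vectors are balanced** (first-order condition of Kempf–Ness type).  If `B`
minimises `Σ ‖B i j‖²` on a set stable under the torus `B ↦ D B D⁻¹`, then for every `i` the
`i`-th row and the `i`-th column of `(‖B j l‖²)` have the same sum: scaling row `i` by `t` and
column `i` by `t⁻¹` does not decrease the norm, for all `t > 0`. [folklore] -/
theorem balanced_of_min [DecidableEq m] {S : Set (Matrix m m ℂ)}
    (hS : ∀ (d : m → ℂˣ) (B : Matrix m m ℂ), B ∈ S →
      (fun i j => (d i : ℂ) * B i j * ((d j : ℂ))⁻¹ : Matrix m m ℂ) ∈ S)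
    {B : Matrix m m ℂ} (hB : B ∈ S)
    (hmin : ∀ B' ∈ S, ∑ i, ∑ j, ‖B i j‖ ^ 2 ≤ ∑ i, ∑ j, ‖B' i j‖ ^ 2) (i : m) :
    ∑ j, ‖B i j‖ ^ 2 = ∑ j, ‖B j i‖ ^ 2 := by
  set P := ∑ l ∈ univ.erase i, ‖B i l‖ ^ 2 with hP
  set Q := ∑ j ∈ univ.erase i, ‖B j i‖ ^ 2 with hQ
  suffices hPQ : P = Q by
    rw [← Finset.add_sum_erase _ _ (Finset.mem_univ i),
      ← Finset.add_sum_erase _ (fun j => ‖B j i‖ ^ 2) (Finset.mem_univ i)]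
    change ‖B i i‖ ^ 2 + P = ‖B i i‖ ^ 2 + Q
    rw [hPQ]
  have hPnn : 0 ≤ P := Finset.sum_nonneg (fun _ _ => by positivity)
  have hQnn : 0 ≤ Q := Finset.sum_nonneg (fun _ _ => by positivity)
  apply eq_of_forall_scaling_le hPnn hQnn
  intro t ht
  set d : m → ℂˣ := Function.update 1 i (Units.mk0 (t : ℂ) (by exact_mod_cast ht.ne')) with hd
  have hdi : (d i : ℂ) = t := by simp [hd]
  have hdj : ∀ j, j ≠ i → (d j : ℂ) = 1 := fun j hj => by simp [hd, Function.update_of_ne hj]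
  set B₁ : Matrix m m ℂ := fun j l => (d j : ℂ) * B j l * ((d l : ℂ))⁻¹ with hB₁
  have hle := hmin B₁ (hS d B hB)
  have e1 := sum_sum_split (fun j l => ‖B j l‖ ^ 2) i
  have e2 := sum_sum_split (fun j l => ‖B₁ j l‖ ^ 2) i
  have ht2 : ‖(t : ℂ)‖ = t := by rw [Complex.norm_real, Real.norm_eq_abs, abs_of_pos ht]
  have hB₁a : ∀ j l, B₁ j l = (d j : ℂ) * B j l * ((d l : ℂ))⁻¹ := fun j l => rfl
  have c0 : ‖B₁ i i‖ ^ 2 = ‖B i i‖ ^ 2 := by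
    rw [hB₁a, hdi, norm_mul, norm_mul, norm_inv, ht2]
    field_simp
  have c1 : ∑ l ∈ univ.erase i, ‖B₁ i l‖ ^ 2 = t ^ 2 * P := by
    rw [hP, Finset.mul_sum]
    refine Finset.sum_congr rfl (fun l hl => ?_)
    rw [hB₁a, hdi, hdj l (Finset.mem_erase.mp hl).1, norm_mul, norm_mul, ht2]
    simp; ring
  have c2 : ∑ j ∈ univ.erase i, ‖B₁ j i‖ ^ 2 = (t ^ 2)⁻¹ * Q := by
    rw [hQ, Finset.mul_sum]
    refine Finset.sum_congr rfl (fun j hj => ?_)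
    rw [hB₁a, hdi, hdj j (Finset.mem_erase.mp hj).1, norm_mul, norm_mul, norm_inv, ht2]
    simp; ring
  have c3 : ∑ j ∈ univ.erase i, ∑ l ∈ univ.erase i, ‖B₁ j l‖ ^ 2 =
      ∑ j ∈ univ.erase i, ∑ l ∈ univ.erase i, ‖B j l‖ ^ 2 := by
    refine Finset.sum_congr rfl (fun j hj => Finset.sum_congr rfl (fun l hl => ?_))
    rw [hB₁a, hdj j (Finset.mem_erase.mp hj).1, hdj l (Finset.mem_erase.mp hl).1]
    simp
  rw [e1, e2, c0, c1, c2, c3] at hle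
  linarith

end MinNorm

section Closed

variable {m : Type*} [Fintype m] [DecidableEq m]

omit [DecidableEq m] in
/-- Being balanced (`Σ_j ‖B i j‖² = Σ_j ‖B j i‖²` for all `i`) is a closed condition.
[folklore] -/
theorem isClosed_setOf_balanced :
    IsClosed {B : Matrix m m ℂ | ∀ i, ∑ j, ‖B i j‖ ^ 2 = ∑ j, ‖B j i‖ ^ 2} := by
  simp only [Set.setOf_forall]
  exact isClosed_iInter fun i => isClosed_eq (by fun_prop) (by fun_prop)

/-- **Uniform lower bound.** There is `δ > 0` such that every balanced matrix with entries of
modulus `≤ 1`, one of which has modulus `1`, satisfies `Σ_{I ≠ ∅} ‖B_I‖ ≥ δ`.  The set of such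
matrices is compact and the continuous function `Σ_{I ≠ ∅} ‖B_I‖` does not vanish on it: if all
principal minors of `B` vanished, the null-cone lemma would kill all diagonal entries and cycle
monomials of `B`, whereas a balanced nonzero `B` has a loop or cycle with nonzero entries
(`exists_heavy_cycle`). [cite: LinSturmfels2009, Corollary 8] -/
theorem exists_pos_lower_bound (m : Type*) [Fintype m] [DecidableEq m] :
    ∃ δ : ℝ, 0 < δ ∧ ∀ B : Matrix m m ℂ, (∀ i j, ‖B i j‖ ≤ 1) →
      (∀ i, ∑ j, ‖B i j‖ ^ 2 = ∑ j, ‖B j i‖ ^ 2) → (∃ i j, ‖B i j‖ = 1) →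
      δ ≤ ∑ I ∈ (univ : Finset (Finset m)).erase ∅, ‖principalMinorMap B I‖ := by
  classical
  set Z : Set (Matrix m m ℂ) := {B | (∀ i j, ‖B i j‖ ≤ 1) ∧
      (∀ i, ∑ j, ‖B i j‖ ^ 2 = ∑ j, ‖B j i‖ ^ 2) ∧ ∃ i j, ‖B i j‖ = 1} with hZ
  set g : Matrix m m ℂ → ℝ := fun B =>
    ∑ I ∈ (univ : Finset (Finset m)).erase ∅, ‖principalMinorMap B I‖ with hg
  have hgcont : Continuous g := by
    refine continuous_finsetSum _ (fun I _ => ?_)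
    exact ((continuous_apply I).comp continuous_principalMinorMap).norm
  have hZc : IsCompact Z := by
    refine (isCompact_box 1).of_isClosed_subset ?_ (fun B hB => hB.1)
    refine (isCompact_box 1).isClosed.inter (isClosed_setOf_balanced.inter ?_)
    show IsClosed {B : Matrix m m ℂ | ∃ i j, ‖B i j‖ = 1}
    simp only [Set.setOf_exists]
    exact isClosed_iUnion_of_finite fun i => isClosed_iUnion_of_finite fun j =>
      isClosed_eq (by fun_prop) (by fun_prop)
  suffices hδ : ∃ δ : ℝ, 0 < δ ∧ ∀ B ∈ Z, δ ≤ g B by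
    obtain ⟨δ, hδ, h⟩ := hδ
    exact ⟨δ, hδ, fun B h1 h2 h3 => h B ⟨h1, h2, h3⟩⟩
  by_cases hZne : Z.Nonempty
  · obtain ⟨B₀, hB₀, hmin⟩ := hZc.exists_isMinOn hZne hgcont.continuousOn
    refine ⟨g B₀, ?_, fun B hB => hmin hB⟩
    by_contra hle
    push Not at hle
    have hsum : g B₀ = 0 := le_antisymm hle (Finset.sum_nonneg fun I _ => norm_nonneg _)
    have hg0 := (Finset.sum_eq_zero_iff_of_nonneg (fun I _ => norm_nonneg _)).mp hsum
    have h0 : ∀ I : Finset m, I.Nonempty → principalMinorMap B₀ I = 0 := fun I hI =>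
      norm_eq_zero.mp (hg0 I (Finset.mem_erase.mpr ⟨hI.ne_empty, Finset.mem_univ _⟩))
    obtain ⟨hdiag, hcyc⟩ := nullCone B₀ h0
    obtain ⟨-, hbal, u, v, huv⟩ := hB₀
    obtain ⟨⟨u', v'⟩, -, hmax⟩ := Finset.exists_max_image (univ : Finset (m × m))
      (fun q => ‖B₀ q.1 q.2‖ ^ 2) ⟨⟨u, v⟩, Finset.mem_univ _⟩
    have hpos : 0 < ‖B₀ u' v'‖ ^ 2 := by
      have := hmax ⟨u, v⟩ (Finset.mem_univ _)
      simp only [huv, one_pow] at this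
      linarith
    have hθ : 0 < ‖B₀ u' v'‖ ^ 2 / (2 * (Fintype.card m : ℝ) ^ 2) := by
      have : Nonempty m := ⟨u⟩
      have : (0 : ℝ) < Fintype.card m := by exact_mod_cast Fintype.card_pos (α := m)
      positivity
    rcases exists_heavy_cycle (fun a b => ‖B₀ a b‖ ^ 2) (fun _ _ => by positivity) hbal u' v'
      hpos with ⟨a, ha⟩ | ⟨σ, hσ, hσH⟩
    · have : 0 < ‖B₀ a a‖ ^ 2 := lt_of_lt_of_le hθ ha
      rw [hdiag a] at this
      simp at this
    · refine (Finset.prod_ne_zero_iff.mpr fun z hz h0' => ?_) (hcyc σ hσ)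
      have := lt_of_lt_of_le hθ (hσH z hz)
      rw [h0'] at this
      simp at this
  · exact ⟨1, one_pos, fun B hB => (hZne ⟨B, hB⟩).elim⟩

/-- **Bounded minors force bounded balanced representatives** (the substitute for
[LinSturmfels2009], Cor. 8 + Lemma 9): for every `R` there is `M` such that every balanced
matrix all of whose nonempty principal minors have modulus `≤ R` has all entries of modulus
`≤ M`.  (Rescale by the largest entry `μ > 1` and apply `exists_pos_lower_bound`:
`δ ≤ Σ_I μ^{-|I|} ‖B_I‖ ≤ (2^n - 1) R / μ`.) [cite: LinSturmfels2009, Corollary 8] -/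
theorem exists_entry_bound (m : Type*) [Fintype m] [DecidableEq m] (R : ℝ) :
    ∃ M : ℝ, ∀ B : Matrix m m ℂ, (∀ i, ∑ j, ‖B i j‖ ^ 2 = ∑ j, ‖B j i‖ ^ 2) →
      (∀ I : Finset m, I.Nonempty → ‖principalMinorMap B I‖ ≤ R) → ∀ i j, ‖B i j‖ ≤ M := by
  classical
  obtain ⟨δ, hδpos, hδ⟩ := exists_pos_lower_bound m
  set C : ℝ := (((univ : Finset (Finset m)).erase ∅).card : ℝ) with hC
  refine ⟨max 1 (C * R / δ), ?_⟩
  intro B hbal hR i j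
  by_contra hlt
  push Not at hlt
  obtain ⟨⟨u, v⟩, -, hmax⟩ := Finset.exists_max_image (univ : Finset (m × m))
    (fun q => ‖B q.1 q.2‖) ⟨⟨i, j⟩, Finset.mem_univ _⟩
  have hμij : ‖B i j‖ ≤ ‖B u v‖ := hmax ⟨i, j⟩ (Finset.mem_univ _)
  set μ := ‖B u v‖ with hμ
  have hμ1 : 1 < μ := lt_of_le_of_lt (le_max_left _ _) (hlt.trans_le hμij)
  have hμpos : 0 < μ := by linarith
  have hR0 : 0 ≤ R := le_trans (norm_nonneg _) (hR {i} (Finset.singleton_nonempty i))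
  have hnμ : ‖((μ : ℂ))⁻¹‖ = μ⁻¹ := by
    rw [norm_inv, Complex.norm_real, Real.norm_eq_abs, abs_of_pos hμpos]
  -- the normalised matrix
  set B' : Matrix m m ℂ := ((μ : ℂ))⁻¹ • B with hB'
  have hB'entry : ∀ a b, ‖B' a b‖ = μ⁻¹ * ‖B a b‖ := fun a b => by
    rw [hB', Matrix.smul_apply, smul_eq_mul, norm_mul, hnμ]
  have h1 : ∀ a b, ‖B' a b‖ ≤ 1 := fun a b => by
    rw [hB'entry, inv_mul_le_iff₀ hμpos, mul_one]
    exact hmax ⟨a, b⟩ (Finset.mem_univ _)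
  have h2 : ∀ a, ∑ b, ‖B' a b‖ ^ 2 = ∑ b, ‖B' b a‖ ^ 2 := fun a => by
    simp only [hB'entry, mul_pow, ← Finset.mul_sum, hbal a]
  have h3 : ∃ a b, ‖B' a b‖ = 1 := ⟨u, v, by rw [hB'entry, ← hμ, inv_mul_cancel₀ hμpos.ne']⟩
  have hgB' : ∑ I ∈ (univ : Finset (Finset m)).erase ∅, ‖principalMinorMap B' I‖ ≤
      C * (μ⁻¹ * R) := by
    calc ∑ I ∈ (univ : Finset (Finset m)).erase ∅, ‖principalMinorMap B' I‖
          ≤ ∑ I ∈ (univ : Finset (Finset m)).erase ∅, μ⁻¹ * R :=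
            Finset.sum_le_sum (fun I hI => ?_)
      _ = C * (μ⁻¹ * R) := by simp [Finset.sum_const, nsmul_eq_mul, hC]
    have hIne : I.Nonempty := Finset.nonempty_iff_ne_empty.mpr (Finset.mem_erase.mp hI).1
    rw [hB', principalMinorMap_smul, norm_mul, norm_pow, hnμ]
    have hk : I.card ≠ 0 := (Finset.card_pos.mpr hIne).ne'
    have h1' : μ⁻¹ ^ I.card ≤ μ⁻¹ :=
      pow_le_of_le_one (by positivity) (inv_le_one_of_one_le₀ hμ1.le) hk
    exact mul_le_mul h1' (hR I hIne) (norm_nonneg _) (by positivity)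
  have hδB' := hδ B' h1 h2 h3
  have hμle : μ ≤ C * R / δ := by
    rw [le_div_iff₀ hδpos]
    have := mul_le_mul_of_nonneg_right (hδB'.trans hgB') hμpos.le
    calc μ * δ = δ * μ := mul_comm _ _
      _ ≤ C * (μ⁻¹ * R) * μ := this
      _ = C * R := by field_simp
  linarith [le_max_right 1 (C * R / δ)]

/-- **Bounded representatives in the fibres.** For every `R` there is `M` such that every matrix
`A` whose nonempty principal minors have modulus `≤ R` has the same principal minors as some
matrix `B` with all `‖B i j‖ ≤ M`: take a minimum-norm point of the orbit closure of `A`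
(`exists_invariant_closed_set`, `exists_min_sqNorm`); it is balanced (`balanced_of_min`) and has
the same, bounded, principal minors, so `exists_entry_bound` applies.  This is the statement the
printed proof extracts from Cor. 8 and Lemma 9. [cite: LinSturmfels2009, Lemma 9] -/
theorem exists_bounded_representative (m : Type*) [Fintype m] [DecidableEq m] (R : ℝ) :
    ∃ M : ℝ, ∀ A : Matrix m m ℂ, (∀ I : Finset m, I.Nonempty → ‖principalMinorMap A I‖ ≤ R) →
      ∃ B : Matrix m m ℂ, principalMinorMap B = principalMinorMap A ∧ ∀ i j, ‖B i j‖ ≤ M := by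
  obtain ⟨M, hM⟩ := exists_entry_bound m R
  refine ⟨M, fun A hA => ?_⟩
  obtain ⟨S, hSc, hAS, hSt, hSφ⟩ := exists_invariant_closed_set A
  obtain ⟨B, hB, hmin⟩ := exists_min_sqNorm hSc hAS
  refine ⟨B, hSφ B hB, hM B (balanced_of_min hSt hB hmin) (fun I hI => ?_)⟩
  rw [hSφ B hB]; exact hA I hI

/-- **Lin–Sturmfels 2009, Theorem 1** (for square matrices over `ℂ` indexed by any finite type):
the image of the affine principal minor map `A ↦ (det A_I)_{I ⊆ m}` is closed in `ℂ^{2^m}`.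
If `u` is in the closure of the image, the image points in the unit ball around `u` have bounded
coordinates, hence (by `exists_bounded_representative`) come from the compact box `‖B i j‖ ≤ M`,
whose image is compact, hence closed, and contains `u`. [cite: LinSturmfels2009, Theorem 1] -/
theorem isClosed_range_principalMinorMap (m : Type*) [Fintype m] [DecidableEq m] :
    IsClosed (Set.range (principalMinorMap : Matrix m m ℂ → Finset m → ℂ)) := by
  apply isClosed_of_closure_subset
  intro u hu
  obtain ⟨M, hM⟩ := exists_bounded_representative m (‖u‖ + 1)
  set φ : Matrix m m ℂ → Finset m → ℂ := principalMinorMap with hφ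
  set box : Set (Matrix m m ℂ) := {A | ∀ i j, ‖A i j‖ ≤ M} with hbox
  have hKc : IsCompact (φ '' box) := (isCompact_box M).image continuous_principalMinorMap
  have hsub : Metric.ball u 1 ∩ Set.range φ ⊆ φ '' box := by
    rintro _ ⟨hx, A, rfl⟩
    have hR : ∀ I : Finset m, I.Nonempty → ‖principalMinorMap A I‖ ≤ ‖u‖ + 1 := by
      intro I _
      refine (norm_le_pi_norm (principalMinorMap A) I).trans ?_
      have h1 : ‖φ A - u‖ < 1 := by rwa [Metric.mem_ball, dist_eq_norm] at hx
      have h2 := norm_sub_norm_le (φ A) u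
      change ‖φ A‖ ≤ ‖u‖ + 1
      linarith
    obtain ⟨B, hB, hBM⟩ := hM A hR
    exact ⟨B, hBM, hB⟩
  have h1 : u ∈ closure (Metric.ball u 1 ∩ Set.range φ) :=
    Metric.isOpen_ball.inter_closure ⟨Metric.mem_ball_self one_pos, hu⟩
  have h2 : u ∈ φ '' box := by
    rw [← hKc.isClosed.closure_eq]
    exact closure_mono hsub h1
  obtain ⟨B, -, rfl⟩ := h2
  exact ⟨B, rfl⟩

end Closed

end LinSturmfels

/-- **Discharge of the named fact** `linSturmfels2009_isClosed_range_principalMinorMap`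
(Lin–Sturmfels 2009, Theorem 1: the image of the affine principal minor map
`Matrix (Fin n) (Fin n) ℂ → (Finset (Fin n) → ℂ)` is closed, for every `n`), by
`LinSturmfels.isClosed_range_principalMinorMap`. [cite: LinSturmfels2009, Theorem 1] -/
theorem linSturmfels2009_isClosed_range_principalMinorMap_holds :
    linSturmfels2009_isClosed_range_principalMinorMap :=
  fun n => LinSturmfels.isClosed_range_principalMinorMap (Fin n)

end Literature.LinearAlgebra.Matrix
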